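import Summits.KontsevichZagierPeriods.KontsevichZagierPeriods.Theorems.IsogenyCertificatesOneSheetTransfer
import Literature.NumberTheory.EllipticCurves.IsogenyFormulaCertKronecker

/-!
# One-sheet transfer: the hypotheses from kernel-checked integer data (route IsogenyCertificates)

Companion of `IsogenyCertificatesOneSheetTransfer` (support for item stmt-KontsevichZagierPeriods-6744).
All analytic hypotheses of `OneSheetTransfer.transfer_mem_changeOfVariablesRel` are derived from
integer coefficient lists (constant term first) of the tree's `Literature.NumberTheory.EllipticCurves.PolyCert`
(`ofList`, `addL`, `mulL`, `evalL`, `IsogenyCert.checkFast`), so that a concrete instance is closed by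
`decide +kernel`:

* `identity_of_checkFast`: the pulled-back curve equation from `IsogenyCert.checkFast` (Kronecker
  substitution; short models, `T = 0`);
* `ofList_eq_derivative`: a list is the derivative of another (finitely many entry checks);
* `normalisation_of_isZeroL`: `p·S = q·(U'h − 2Uh')` from a vanishing list (`c = p/q`);
* `degree_sq_lt_degree`, `leadingCoeff_ratio_pos`: `deg h² < deg U`, positive leading ratio;
* `eval_pos_of_shiftCert`: **sign certificate on a half-line** — if a list `Ls` agrees with
  `d^m·L((u + n)/d)` at `m + 1` integer points (so they are equal as polynomials, by Lagrange) and
  has non-negative entries with positive constant term, then `L > 0` on `[n/d, ∞)` (the Taylor-shift /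
  Budan–Fourier test; Basu–Pollack–Roy, *Algorithms in Real Algebraic Geometry*, §2.2);
* `isSemialgebraicMapOn_xMap`: `p ↦ U(p 0)/h(p 0)²` is `ℚ`-semialgebraic on `{P > 0}`;
* `transfer_of_listCert`: everything bundled — the conclusion of Part B from closed `Bool` checks.

No definitions are introduced (data enter as list literals in the instance files).

References: Kontsevich–Zagier 2001 §1.2; Silverman AEC (2009) III.4.8, Rem. III.4.13.3;
S. Basu, R. Pollack, M.-F. Roy, *Algorithms in Real Algebraic Geometry* (2006), §2.2 (Budan–Fourier).
-/

noncomputable section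

open Set Filter Polynomial
open Literature.NumberTheory.Transcendental Literature.ModelTheory.ExponentialFields
open Literature.NumberTheory.EllipticCurves.PolyCert
open Summit.KontsevichZagierPeriods.HermiteRigidity.GenusTwoCycleTransfer
  (det_smul_id_fin_one hasFDerivAt_fin_one)

namespace Summit.KontsevichZagierPeriods.IsogenyCertificates.OneSheetTransfer

/-! ### Part C: the hypotheses of Part B from kernel-checked integer data -/

/-- `{p | 0 < (p 0)³ + A (p 0) + B} ⊆ ℝ¹` is `ℚ`-semialgebraic. [cite: BochnakCosteRoy1998, Def. 2.1.4] -/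
theorem isSemialgebraic_cubicPos (A B : ℤ) :
    IsSemialgebraic ℚ {p : Fin 1 → ℝ | 0 < p 0 ^ 3 + (A : ℝ) * p 0 + B} := by
  convert isSemialgebraic_setOf_eval_pos (k := ℚ) (R := ℝ)
    (MvPolynomial.X 0 ^ 3 + MvPolynomial.C (A : ℚ) * MvPolynomial.X 0 + MvPolynomial.C (B : ℚ) :
      MvPolynomial (Fin 1) ℚ) using 2 with p
  simp

/-- Evaluation of `ofList p` (read in `ℝ[X]`) at an integer is the Horner value `evalL`. [folklore] -/
theorem eval_intCast_ofList (k : ℤ) : ∀ p : List ℤ, (ofList p : ℝ[X]).eval (k : ℝ) = (evalL k p : ℝ)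
  | [] => by simp
  | a :: p => by
      rw [ofList_cons, eval_add, eval_C, eval_mul, eval_X, eval_intCast_ofList k p, evalL_cons]
      push_cast
      ring

/-- `aeval` of the one-variable polynomial `ofList q` transported to `MvPolynomial (Fin 1) ℚ`.
[folklore] -/
theorem mvAeval_ofList (q : List ℤ) (p : Fin 1 → ℝ) :
    MvPolynomial.aeval p (Polynomial.aeval (MvPolynomial.X 0 : MvPolynomial (Fin 1) ℚ)
      (ofList q : ℚ[X])) = (ofList q : ℝ[X]).eval (p 0) := by
  rw [← Polynomial.aeval_algHom_apply, MvPolynomial.aeval_X, Polynomial.aeval_def,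
    ← Polynomial.eval_map, IsogenyCert.map_ofList]

/-- The x-map `p ↦ U(p 0)/h(p 0)²` of integer coefficient lists is a `ℚ`-semialgebraic map on
`{P > 0}` as soon as `h` does not vanish there. [cite: BochnakCosteRoy1998, §2.2] -/
theorem isSemialgebraicMapOn_xMap (A B : ℤ) (UL hL : List ℤ)
    (hh : ∀ p : Fin 1 → ℝ, 0 < p 0 ^ 3 + (A : ℝ) * p 0 + B → (ofList hL : ℝ[X]).eval (p 0) ≠ 0) :
    IsSemialgebraicMapOn ℚ {p : Fin 1 → ℝ | 0 < p 0 ^ 3 + (A : ℝ) * p 0 + B}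
      (fun (p : Fin 1 → ℝ) (_ : Fin 1) =>
        (ofList UL : ℝ[X]).eval (p 0) / ((ofList hL : ℝ[X]).eval (p 0)) ^ 2) := by
  have hσ := isSemialgebraic_cubicPos A B
  refine IsSemialgebraicMapOn.of_forall hσ fun _ => ?_
  have hQ : ∀ p : Fin 1 → ℝ, MvPolynomial.aeval p (Polynomial.aeval
      (MvPolynomial.X 0 : MvPolynomial (Fin 1) ℚ) ((ofList hL : ℚ[X]) ^ 2)) =
      ((ofList hL : ℝ[X]).eval (p 0)) ^ 2 := by
    intro p
    rw [map_pow, map_pow, mvAeval_ofList]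
  have h := isSemialgebraicFunOn_aeval_div_aeval hσ
    (Polynomial.aeval (MvPolynomial.X 0 : MvPolynomial (Fin 1) ℚ) (ofList UL : ℚ[X]))
    (Polynomial.aeval (MvPolynomial.X 0 : MvPolynomial (Fin 1) ℚ) ((ofList hL : ℚ[X]) ^ 2))
    (fun p hp => by rw [hQ]; exact pow_ne_zero 2 (hh p hp))
  exact h.congr fun p _ => by simp only [mvAeval_ofList, hQ]

/-- **The pulled-back curve equation from a fast-checked isogeny certificate** (short models,
`T = 0`): `U³ + A'Uh⁴ + B'h⁶ = S²·(x³ + Ax + B)` pointwise on `ℝ`.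
[cite: SilvermanAEC2009, Thm. III.4.8 and Remark III.4.13.3] -/
theorem identity_of_checkFast (A B A' B' : ℤ) (UL hL SL : List ℤ) (k : ℕ)
    (hc : IsogenyCert.checkFast ⟨0, 0, 0, A, B, 0, 0, 0, A', B', UL, hL, SL, []⟩ k = true)
    (x : ℝ) :
    ((ofList UL : ℝ[X]).eval x) ^ 3 + (A' : ℝ) * (ofList UL : ℝ[X]).eval x *
        ((ofList hL : ℝ[X]).eval x) ^ 4 + (B' : ℝ) * ((ofList hL : ℝ[X]).eval x) ^ 6 =
      ((ofList SL : ℝ[X]).eval x) ^ 2 * (x ^ 3 + (A : ℝ) * x + B) := by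
  have H := ofList_eq_zero_of_isZeroL (R := ℝ) _ (IsogenyCert.isZeroL_id₀L_of_checkFast hc)
  simp only [IsogenyCert.id₀L, ofList_subL, ofList_addL, ofList_mulL, ofList_smulL, ofList_cons,
    ofList_nil, Int.cast_zero, Int.cast_one, map_zero, map_one, mul_zero, add_zero, zero_mul,
    zero_add] at H
  have H' := congrArg (Polynomial.eval x) H
  simp only [eval_add, eval_sub, eval_mul, eval_C, eval_X, eval_zero, eval_one] at H'
  linear_combination (-1 : ℝ) * H'

/-- A list `d` is the derivative of a list `p` when its entries are `(n+1)·p_{n+1}`; the finitely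
many entry checks are decidable. [folklore] -/
theorem ofList_eq_derivative (p d : List ℤ) (hlen : d.length ≤ p.length)
    (h : ∀ n, n < p.length → coeffL d n = (n + 1) * coeffL p (n + 1)) :
    (ofList d : ℝ[X]) = derivative (ofList p) := by
  ext n
  rw [coeff_derivative, coeff_ofList, coeff_ofList]
  rcases lt_or_ge n p.length with hn | hn
  · rw [h n hn]
    push_cast
    ring
  · rw [coeffL_eq_zero_of_le d n (hlen.trans hn), coeffL_eq_zero_of_le p (n + 1) (by omega)]
    simp

/-- **The normalisation identity from a list certificate**: if `p·S − q·(U'h − 2Uh')` is a list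
of zeros then `p·S(x) = q·(U'(x)h(x) − 2U(x)h'(x))` pointwise. [folklore] -/
theorem normalisation_of_isZeroL (UL hL SL dUL dhL : List ℤ) (p q : ℤ)
    (hz : isZeroL (subL (smulL p SL) (smulL q (subL (mulL dUL hL) (smulL 2 (mulL UL dhL))))) = true)
    (hdU : (ofList dUL : ℝ[X]) = derivative (ofList UL))
    (hdh : (ofList dhL : ℝ[X]) = derivative (ofList hL)) (x : ℝ) :
    (p : ℝ) * (ofList SL : ℝ[X]).eval x =
      q * ((derivative (ofList UL : ℝ[X])).eval x * (ofList hL : ℝ[X]).eval x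
        - 2 * (ofList UL : ℝ[X]).eval x * (derivative (ofList hL : ℝ[X])).eval x) := by
  have H := ofList_eq_zero_of_isZeroL (R := ℝ) _ hz
  simp only [ofList_subL, ofList_smulL, ofList_mulL, hdU, hdh] at H
  have H' := congrArg (Polynomial.eval x) H
  simp only [eval_sub, eval_mul, eval_C, eval_zero, Int.cast_ofNat] at H'
  linear_combination H'

/-- The degree condition `deg h² < deg U` from the list lengths and a non-zero last entry of `U`.
[folklore] -/
theorem degree_sq_lt_degree (UL hL : List ℤ) (hlt : 2 * (hL.length - 1) < UL.length - 1)
    (hU : coeffL UL (UL.length - 1) ≠ 0) :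
    ((ofList hL : ℝ[X]) ^ 2).degree < (ofList UL : ℝ[X]).degree := by
  apply Polynomial.degree_lt_degree
  calc ((ofList hL : ℝ[X]) ^ 2).natDegree ≤ 2 * (ofList hL : ℝ[X]).natDegree := natDegree_pow_le
    _ ≤ 2 * (hL.length - 1) := Nat.mul_le_mul_left 2 (natDegree_ofList_le hL)
    _ < UL.length - 1 := hlt
    _ ≤ (ofList UL : ℝ[X]).natDegree := le_natDegree_ofList UL _ hU

/-- Positive ratio of leading coefficients from the last listed entries. [folklore] -/
theorem leadingCoeff_ratio_pos (UL hL : List ℤ) (hU : 0 < coeffL UL (UL.length - 1))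
    (hh : coeffL hL (hL.length - 1) ≠ 0) :
    0 < (ofList UL : ℝ[X]).leadingCoeff / ((ofList hL : ℝ[X]) ^ 2).leadingCoeff := by
  rw [leadingCoeff_pow]
  apply div_pos
  · rw [leadingCoeff, IsogenyCert.natDegree_ofList_eq UL hU.ne', coeff_ofList]
    exact_mod_cast hU
  · have h0 : (ofList hL : ℝ[X]).leadingCoeff ≠ 0 := by
      rw [leadingCoeff, IsogenyCert.natDegree_ofList_eq hL hh, coeff_ofList]
      exact_mod_cast hh
    positivity

/-- A coefficient list with non-negative entries is non-negative on `[0, ∞)`. [folklore] -/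
theorem eval_nonneg_of_all_nonneg :
    ∀ p : List ℤ, (p.all fun a => decide (0 ≤ a)) = true →
      ∀ u : ℝ, 0 ≤ u → 0 ≤ (ofList p : ℝ[X]).eval u
  | [], _, u, _ => by simp
  | a :: p, h, u, hu => by
      simp only [List.all_cons, Bool.and_eq_true, decide_eq_true_eq] at h
      rw [ofList_cons, eval_add, eval_C, eval_mul, eval_X]
      exact add_nonneg (by exact_mod_cast h.1) (mul_nonneg hu (eval_nonneg_of_all_nonneg p h.2 u hu))

/-- A coefficient list with non-negative entries and positive constant term is positive on
`[0, ∞)`. [folklore] -/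
theorem eval_pos_of_all_nonneg (p : List ℤ) (h : (p.all fun a => decide (0 ≤ a)) = true)
    (h0 : 0 < coeffL p 0) (u : ℝ) (hu : 0 ≤ u) : 0 < (ofList p : ℝ[X]).eval u := by
  cases p with
  | nil => simp [coeffL] at h0
  | cons a p =>
      simp only [List.all_cons, Bool.and_eq_true, decide_eq_true_eq] at h
      change 0 < a at h0
      rw [ofList_cons, eval_add, eval_C, eval_mul, eval_X]
      have h1 := eval_nonneg_of_all_nonneg p h.2 u hu
      have ha : (0 : ℝ) < a := by exact_mod_cast h0
      positivity

/-- **Sign certificate on a half-line** (Budan–Fourier / Taylor shift): let `L` be an integer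
coefficient list of length `m + 1`, `d ≥ 1`, `n` integers, and `Ls` a list of length `≤ m + 1`
whose Horner values at the `m + 1` integers `d·j − n` (`0 ≤ j ≤ m`) are `d^m · L(j)` — so that
`Ls(u) = d^m · L((u + n)/d)` as polynomials — with all entries `≥ 0` and constant term `> 0`. Then
`L(x) > 0` for every real `x ≥ n/d`. All hypotheses on `L, Ls, n, d` are decidable.
[cite: BasuPollackRoy2006, Thm. 2.35 (Budan–Fourier)] -/
theorem eval_pos_of_shiftCert (L Ls : List ℤ) (n : ℤ) (d : ℕ) (hd : 0 < d)
    (hlen : Ls.length ≤ L.length)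
    (hrel : ∀ j : ℕ, j < L.length →
      evalL ((d : ℤ) * j - n) Ls = (d : ℤ) ^ (L.length - 1) * evalL j L)
    (hnonneg : (Ls.all fun a => decide (0 ≤ a)) = true) (h0 : 0 < coeffL Ls 0)
    (x : ℝ) (hx : (n : ℝ) ≤ d * x) : 0 < (ofList L : ℝ[X]).eval x := by
  -- `L` is non-empty
  have hL0 : L ≠ [] := by
    rintro rfl
    have : Ls = [] := List.eq_nil_of_length_eq_zero (Nat.le_zero.mp (by simpa using hlen))
    subst this
    simp [coeffL] at h0
  set m := L.length - 1 with hm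
  have hLm : L.length = m + 1 := by
    have := List.length_pos_of_ne_nil hL0
    omega
  have hdR : (d : ℝ) ≠ 0 := by exact_mod_cast hd.ne'
  -- the comparison polynomial `Q = d^m · L((X + n)/d)`
  set Q : ℝ[X] := C ((d : ℝ) ^ m) * (ofList L : ℝ[X]).comp (C (1 / (d : ℝ)) * X + C ((n : ℝ) / d))
    with hQ
  have hQeval : ∀ y : ℝ, Q.eval y = (d : ℝ) ^ m * (ofList L : ℝ[X]).eval ((y + n) / d) := by
    intro y
    simp only [hQ, eval_mul, eval_C, eval_comp, eval_add, eval_X]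
    congr 2
    field_simp
  -- `ofList Ls = Q`: both have degree `≤ m` and they agree at the `m + 1` points `d j − n`
  set s : Finset ℝ := (Finset.range (m + 1)).image fun j : ℕ => (d : ℝ) * j - n with hs
  have hcard : s.card = m + 1 := by
    rw [hs, Finset.card_image_of_injective _ ?_, Finset.card_range]
    intro i j hij
    have : (d : ℝ) * i = d * j := by simpa using hij
    exact_mod_cast (mul_left_cancel₀ hdR this)
  have hdegLs : (ofList Ls : ℝ[X]).degree < s.card := by
    rw [hcard]
    refine (degree_le_of_natDegree_le (natDegree_ofList_le Ls)).trans_lt ?_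
    exact_mod_cast (show Ls.length - 1 < m + 1 by omega)
  have hdegQ : Q.degree < s.card := by
    rw [hcard]
    refine (degree_le_of_natDegree_le ?_).trans_lt (by exact_mod_cast Nat.lt_succ_self m)
    refine (natDegree_C_mul_le _ _).trans ((natDegree_comp_le).trans ?_)
    calc (ofList L : ℝ[X]).natDegree * (C (1 / (d : ℝ)) * X + C ((n : ℝ) / d)).natDegree
        ≤ (L.length - 1) * 1 :=
          Nat.mul_le_mul (natDegree_ofList_le L) natDegree_linear_le
      _ = m := by omega
  have hLsQ : (ofList Ls : ℝ[X]) = Q := by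
    refine Polynomial.eq_of_degrees_lt_of_eval_finset_eq s hdegLs hdegQ ?_
    intro y hy
    rw [hs, Finset.mem_image] at hy
    obtain ⟨j, hj, rfl⟩ := hy
    rw [Finset.mem_range] at hj
    have hj' : j < L.length := by omega
    have h1 : (ofList Ls : ℝ[X]).eval ((d : ℝ) * j - n) = (evalL ((d : ℤ) * j - n) Ls : ℝ) := by
      have := eval_intCast_ofList ((d : ℤ) * j - n) Ls
      push_cast at this
      exact this
    rw [h1, hrel j hj', hQeval]
    have h2 : ((d : ℝ) * j - n + n) / d = (j : ℤ) := by
      field_simp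
      push_cast
      ring
    rw [h2, eval_intCast_ofList]
    push_cast
    ring
  -- evaluate at `u = d x − n ≥ 0`
  have hu : 0 ≤ (d : ℝ) * x - n := by linarith
  have hpos := eval_pos_of_all_nonneg Ls hnonneg h0 _ hu
  rw [hLsQ, hQeval] at hpos
  have h3 : ((d : ℝ) * x - n + n) / d = x := by
    field_simp
    ring
  rw [h3] at hpos
  exact (mul_pos_iff_of_pos_left (by positivity)).mp hpos


/-! ### Part D: everything from decidable integer data -/

/-- **One-sheet transfer from an integer certificate.** All hypotheses except the two
discriminant signs and `p, q, d ≠ 0` are closed `Bool`/bounded-`ℕ` statements about integer lists,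
meant for `decide +kernel`: the fast isogeny-certificate check (pulled-back curve equation), the
derivative lists, the normalisation `p·S = q·(U'h − 2Uh')` (so `c = p/q`), `P(n/d) ≤ 0`, the degree
and leading-coefficient conditions, and the two Taylor-shift sign certificates for `h` and `S` on
`[n/d, ∞)`. Conclusion: for every real `b`, `[{P>0}, b·|p/q|/√P] − [{P'>0}, b/√P']` is one
change-of-variables relation. [cite: KontsevichZagier2001, §1.2 rule (2)] -/
theorem transfer_of_listCert (A B A' B' : ℤ) (UL hL SL dUL dhL hSh SSh : List ℤ) (k : ℕ)
    (p q n : ℤ) (d : ℕ)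
    (hΔ : 0 < 4 * A ^ 3 + 27 * B ^ 2) (hΔ' : 0 < 4 * A' ^ 3 + 27 * B' ^ 2)
    (hp : p ≠ 0) (hq : q ≠ 0) (hd : 0 < d)
    (hcert : IsogenyCert.checkFast ⟨0, 0, 0, A, B, 0, 0, 0, A', B', UL, hL, SL, []⟩ k = true)
    (hdUlen : dUL.length ≤ UL.length)
    (hdU : ∀ i, i < UL.length → coeffL dUL i = (i + 1) * coeffL UL (i + 1))
    (hdhlen : dhL.length ≤ hL.length)
    (hdh : ∀ i, i < hL.length → coeffL dhL i = (i + 1) * coeffL hL (i + 1))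
    (hnormL : isZeroL (subL (smulL p SL)
      (smulL q (subL (mulL dUL hL) (smulL 2 (mulL UL dhL))))) = true)
    (ht₀ : n ^ 3 + A * n * (d : ℤ) ^ 2 + B * (d : ℤ) ^ 3 ≤ 0)
    (hlenU : 2 * (hL.length - 1) < UL.length - 1) (hlcU : 0 < coeffL UL (UL.length - 1))
    (hlch : coeffL hL (hL.length - 1) ≠ 0)
    (hhShlen : hSh.length ≤ hL.length)
    (hhrel : ∀ j : ℕ, j < hL.length →
      evalL ((d : ℤ) * j - n) hSh = (d : ℤ) ^ (hL.length - 1) * evalL j hL)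
    (hhnonneg : (hSh.all fun a => decide (0 ≤ a)) = true) (hh0 : 0 < coeffL hSh 0)
    (hSShlen : SSh.length ≤ SL.length)
    (hSrel : ∀ j : ℕ, j < SL.length →
      evalL ((d : ℤ) * j - n) SSh = (d : ℤ) ^ (SL.length - 1) * evalL j SL)
    (hSnonneg : (SSh.all fun a => decide (0 ≤ a)) = true) (hS0 : 0 < coeffL SSh 0)
    (b : ℝ) (r r' : KZ.IntegralRep 1)
    (h1 : r.domain = {x | 0 < x 0 ^ 3 + (A : ℝ) * x 0 + B})
    (h2 : EqOn r.integrand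
      (fun x => b * |(p : ℝ) / q| / Real.sqrt (x 0 ^ 3 + (A : ℝ) * x 0 + B)) r.domain)
    (h3 : r'.domain = {x | 0 < x 0 ^ 3 + (A' : ℝ) * x 0 + B'})
    (h4 : EqOn r'.integrand (fun x => b / Real.sqrt (x 0 ^ 3 + (A' : ℝ) * x 0 + B')) r'.domain) :
    KZ.of r - KZ.of r' ∈ KZ.changeOfVariablesRel := by
  have hdR : (0 : ℝ) < d := by exact_mod_cast hd
  have hpR : (p : ℝ) ≠ 0 := by exact_mod_cast hp
  have hqR : (q : ℝ) ≠ 0 := by exact_mod_cast hq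
  have hdU' := ofList_eq_derivative UL dUL hdUlen hdU
  have hdh' := ofList_eq_derivative hL dhL hdhlen hdh
  -- the half-line `[n/d, ∞)`
  have hle : ∀ x : ℝ, (n : ℝ) / d ≤ x → (n : ℝ) ≤ d * x := fun x hx => by
    rwa [div_le_iff₀ hdR, mul_comm] at hx
  have hg : ∀ x : ℝ, (n : ℝ) / d ≤ x → 0 < (ofList hL : ℝ[X]).eval x := fun x hx =>
    eval_pos_of_shiftCert hL hSh n d hd hhShlen hhrel hhnonneg hh0 x (hle x hx)
  have hS : ∀ x : ℝ, (n : ℝ) / d ≤ x → (ofList SL : ℝ[X]).eval x ≠ 0 := fun x hx =>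
    (eval_pos_of_shiftCert SL SSh n d hd hSShlen hSrel hSnonneg hS0 x (hle x hx)).ne'
  have ht₀R : ((n : ℝ) / d) ^ 3 + (A : ℝ) * ((n : ℝ) / d) + B ≤ 0 := by
    have h : ((n : ℝ) / d) ^ 3 + (A : ℝ) * ((n : ℝ) / d) + B =
        ((n : ℝ) ^ 3 + A * n * (d : ℝ) ^ 2 + B * (d : ℝ) ^ 3) / (d : ℝ) ^ 3 := by
      field_simp
    rw [h]
    refine div_nonpos_of_nonpos_of_nonneg ?_ (by positivity)
    exact_mod_cast ht₀
  refine transfer_mem_changeOfVariablesRel (c := (p : ℝ) / q) (t₀ := (n : ℝ) / d)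
    (U := ofList UL) (g := ofList hL) (S := ofList SL)
    (by exact_mod_cast hΔ) (by exact_mod_cast hΔ') (div_ne_zero hpR hqR)
    (identity_of_checkFast A B A' B' UL hL SL k hcert) ?_ ht₀R hg hS
    (degree_sq_lt_degree UL hL hlenU hlcU.ne') (leadingCoeff_ratio_pos UL hL hlcU hlch)
    (isSemialgebraicMapOn_xMap A B UL hL fun x hx => ?_) b r r' h1 h2 h3 h4
  · intro x
    have h := normalisation_of_isZeroL UL hL SL dUL dhL p q hnormL hdU' hdh' x
    field_simp
    linear_combination h
  · -- `h ≠ 0` on `{P > 0}` (which lies inside `[n/d, ∞)`)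
    refine (hg (x 0) ?_).ne'
    by_contra hlt
    push Not at hlt
    obtain ⟨ρ, hρ⟩ := cubic_exists_root (A : ℝ) B
    have hΔR : (0 : ℝ) < 4 * (A : ℝ) ^ 3 + 27 * (B : ℝ) ^ 2 := by exact_mod_cast hΔ
    have hρx : ρ < x 0 := (cubic_pos_iff hρ hΔR _).mp hx
    have hρt : ρ < (n : ℝ) / d := hρx.trans hlt
    exact absurd ((cubic_pos_iff hρ hΔR _).mpr hρt) (not_lt.mpr ht₀R)


end Summit.KontsevichZagierPeriods.IsogenyCertificates.OneSheetTransfer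

end
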